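import Summits.BirchSwinnertonDyer.BirchSwinnertonDyer.Theorems.PrintCf2SplitBadTwoNormAtVbarTwistedAssembly
import Summits.BirchSwinnertonDyer.BirchSwinnertonDyer.Theorems.PrintCf2SplitBadTwoNormAtVbarTwistedAssemblyLine
import Summits.BirchSwinnertonDyer.BirchSwinnertonDyer.Theorems.PrintCf2SplitBadTwoQuadraticSignRamification
import HarnessLib

/-!
# Crux `PrintCf2.SplitBadTwoRankOneOfFacts` (stmt-BirchSwinnertonDyer-20368), skeleton v13.5, (REG₂) `stub_xRegular_two` FACT-FREE road, R2 brick
# **B5-T ASSEMBLED IN LAYER CURRENCY** — the twisted `v̄`-readings p712275 / p712897 restated for an ARBITRARY open normal subgroup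
# `U = galFixing K F` (so that `U := κ.layerSubgroup n`, `F := κ.layer n` type-check), and -w8 g5's displayed hypothesis `hB1` of
# `LayerShapiro.xRegularAtTwo_of_decompReading` DISCHARGED

Cell `bsd-print-cf2`, EXTRA WIDTH seat `bsd-line-cf2-p1-w4` g14 (prover-bsd-line-cf2-p1-w4-g14-0); `--supports stmt-BirchSwinnertonDyer-20368`
(helper, Theses-free). HONEST FRAMING: nothing here closes the crux or a registered stub; BSD is not proved by any of this; no summit
statement is proved by this seat. No definition, no named fact, no `sorry`. UNCONDITIONAL.

WHY. The consumers (-w8 g5 `locSurj_layers_twisted` / `xRegularAtTwo_of_decompReading`, HOME `bsd-line-cf2-p1-w8/XRegularAtTwoOfDecompReading_w8g5.lean`;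
-w2 g15's v-line twin) quantify their `v̄`-reading hypothesis over the LAYER SUBGROUP `κ.layerSubgroup n` (cocycles, representatives, Shapiro
lifts all typed by it), while p712275 / p712897 are typed by `galFixing K F`; `galFixing_layer : galFixing K (κ.layer n) = κ.layerSubgroup n`
is propositional, so the passage is a `subst` along a hypothesis `hUF : galFixing K F = U` — done here once:
* **`dvd_log_valuation_of_dualShapiro_mem_twisted_of_eq`** — p712275's `dvd_log_valuation_of_dualShapiro_mem_twisted` for any `U` with
  `[U.Normal]`, `IsOpen U`, `[Fintype (Γ_K ⧸ U)]` and `galFixing K F = U` (all data typed by `U`);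
* **`dvd_mul_log_valuation_of_dualShapiro_mem_twisted_of_eq`** — the same for p712897's line-generic form (slack `[Γ_K : U]`);
* `isOpen_ker_of_iff_unitChar` — `ε′ σ = 1 ↔ unitChar θ′ σ = 1` (`θ′² = 1`) ⟹ `ker ε′` is open (p706639);
* **`twistedVbarReading_B1`** — -w8 g5's `hB1` VERBATIM (all `K` imaginary quadratic with `2 ∤ h_K`, `2 = v v̄`, `κ` unramified outside `v̄`,
  every layer `n`, every quadratic `θ′` with sign `ε′` trivial on `D_v̄`, all sign-level models, representatives, layer cocycles satisfying
  clause (iii) at `v̄`, all Kummer data): the LEFT disjunct `2^M ∣ ord_{w′}(b′)` at every `w′ ∣ v̄` — by `…_of_eq` at `U := κ.layerSubgroup n`,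
  `F := κ.layer n` (`galFixing_layer`), `htot` from -w3 g14's `forall_exists_inertia_mul_mem_galFixing_layer`. With it
  `LayerShapiro.xRegularAtTwo_of_decompReading twistedVbarReading_B1` is the (REG₂) statement (-w8 g5's file (C), to be landed by its owner).
presearch: none (currency bookkeeping over landed theorems). beyond-print theorem: no.

References: [NeukirchSchmidtWingberg2008] I §5–§6; [NeukirchANT1999] Ch. I §9, Ch. II §8; [SerreLocalFields1979] XIV §1 Prop. 3.
-/

noncomputable section

open scoped Classical Pointwise ContRepresentation

set_option linter.dupNamespace false
set_option autoImplicit false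

open CategoryTheory NumberField IsDedekindDomain Field IntermediateField
open Literature.NumberTheory.EllipticCurves Literature.NumberTheory.EllipticCurves.GreenbergSelmer
open Literature.NumberTheory.GaloisRepresentations Literature.NumberTheory.GaloisRepresentations.LocalWeilDatum
open Literature.NumberTheory.GaloisRepresentations.DiscreteGaloisModule (SelmerStructure mu MuCarrier TateDual tateDual
  coindTateDualMor coindTateDualHom unramifiedSubgroup localMap)
open Literature.NumberTheory.GaloisCohomology
open Literature.NumberTheory.EllipticCurves.KellerYin2024 Literature.NumberTheory.IwasawaTheory
open Summit.BirchSwinnertonDyer.Rank1Residual.X11b.LocBridge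

namespace Summit.BirchSwinnertonDyer.BirchSwinnertonDyer.Theorems.PrintCf2.NormAtVbar

/-! ## §1. Arbitrary `U = galFixing K F` -/

section OfEq

variable {K : Type} [Field K] [NumberField K]
  {M : Type} [AddCommGroup M] [TopologicalSpace M] [DiscreteTopology M] [Finite M] (ρ : DiscreteGaloisModule K M)
  {M' : Type} [AddCommGroup M'] [DistribMulAction (absoluteGaloisGroup K) M'] [TopologicalSpace M'] [DiscreteTopology M']
  (hM' : ∀ m : M', IsOpen {σ : absoluteGaloisGroup K | σ • m = m})
  {n : ℕ} [NeZero n] (B : M →+ M' →+ MuCarrier K n)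
  (hB : ∀ (σ : absoluteGaloisGroup K) (m : M) (m' : M'), B (ρ σ m) (ofSMul M' hM' σ m') = mu K n σ (B m m'))
  (U : Subgroup (absoluteGaloisGroup K)) [U.Normal] (hUopen : IsOpen (U : Set (absoluteGaloisGroup K)))
  [Fintype (absoluteGaloisGroup K ⧸ U)]
  (F F' : IntermediateField K (AlgebraicClosure K)) [FiniteDimensional K F'] [IsAbelianGalois K F'] [NumberField F']
  (hUF : galFixing K F = U)
  (ε : absoluteGaloisGroup K →* ℤˣ) (hε : IsOpen ((ε.ker : Subgroup (absoluteGaloisGroup K)) : Set (absoluteGaloisGroup K)))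
  (hU' : galFixing K F' ≤ U) (hεU' : ∀ u ∈ galFixing K F', ε u = 1) (hker : ∀ u ∈ U, ε u = 1 → u ∈ galFixing K F')
  {m₀ : M} (hm₀ : ∀ σ : absoluteGaloisGroup K, ρ σ m₀ = ((ε σ : ℤˣ) : ℤ) • m₀) (hn0 : n • m₀ = 0)
  (hMn' : ∀ x : M', n • x = 0)
  (ι' : M' →+ Additive (AlgebraicClosure K)ˣ) (hι'B : ∀ m' : M', Additive.toMul (ι' m') = muVal K n (B m₀ m'))
  (hι' : ∀ (g : absoluteGaloisGroup K) (x : M'), Additive.toMul (ι' (g • x)) = (g • Additive.toMul (ι' x)) ^ ((ε g : ℤˣ) : ℤ))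

include hUF hε hεU' hker hm₀ hn0 hMn' hι'B hι' in
/-- **p712275 for an arbitrary `U = galFixing K F`** (all data — representatives, layer cocycle, Shapiro lift, `hU′`, `hker`, `htot` — typed by
`U`; `subst` along `galFixing K F = U`). Case (B1) of the twisted `v̄`-reading on the `v̄`-line: `(n : ℤ) ∣ log v_{w′}(b′)` at every `w′ ∣ v̄`.
[cite: SerreLocalFields1979, XIV §1 Prop. 3] [cite: NeukirchSchmidtWingberg2008, I §5 Prop. (1.5.3)(iv), I §6 (1.6.4)] -/
theorem dvd_log_valuation_of_dualShapiro_mem_twisted_of_eq (vbar : HeightOneSpectrum (𝓞 K))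
    (htot : ∀ 𝔓 ∈ vbar.primesAbove, ∀ σ : absoluteGaloisGroup K, ∃ τ ∈ 𝔓.inertia (absoluteGaloisGroup K), τ⁻¹ * σ ∈ U)
    (hεD : ∀ σ ∈ GreenbergSelmer.decomp vbar, ε σ = 1)
    {s : absoluteGaloisGroup K ⧸ U → absoluteGaloisGroup K}
    (hs : ∀ y, (s y : absoluteGaloisGroup K ⧸ U) = y) (hs1 : s ((1 : absoluteGaloisGroup K) : absoluteGaloisGroup K ⧸ U) = 1)
    (φ : contOneCocycles (discreteTopRep U M'))
    (hvbar : galoisCohomology.localization ((ρ.coind U hUopen).tateDual n) (Sum.inr vbar) 1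
        (cohomologyMap (coindTateDualMor ρ (ofSMul M' hM') U B hUopen hB) 1
          (shapiroLift (ofSMul M' hM').toTopRep U hUopen hs hs1 (oneCocycleClass _ φ))) ∈
      (LocalInvariants.canonical K n).dualLocalCondition (ρ.coind U hUopen) (Sum.inr vbar)
        (unramifiedSubgroup (GaloisRep.toLocal vbar (ρ.coind U hUopen)) 1))
    (β : (AlgebraicClosure K)ˣ)
    (hβ : ∀ u : galFixing K F', Additive.toMul (ι' (φ.1 ⟨u, hU' u.2⟩)) = (u : absoluteGaloisGroup K) • β / β)
    (b : F') (hb : ((b : F') : AlgebraicClosure K) = ((β ^ n : (AlgebraicClosure K)ˣ) : AlgebraicClosure K))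
    (w' : vbar.Extension (𝓞 F')) : (n : ℤ) ∣ WithZero.log (w'.1.valuation F' b) := by
  subst hUF
  exact dvd_log_valuation_of_dualShapiro_mem_twisted ρ hM' B hB F F' hUopen ε hε hU' hεU' hker hm₀ hn0 hMn' ι' hι'B hι' vbar htot hεD
    hs hs1 φ hvbar β hβ b hb w'

omit [FiniteDimensional K F'] in
include hUF hε hεU' hker hm₀ hn0 hMn' hι'B hι' in
/-- **p712897 for an arbitrary `U = galFixing K F`** (line-generic form, slack `[Γ_K : U]`): under `Γ_K = D_v̄ · U` and `ε = 1` on `D_v̄`,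
`(n : ℤ) ∣ [Γ_K : U] · log v_{w′}(b′)` at every `w′ ∣ v̄`. [cite: SerreLocalFields1979, XIV §1 Prop. 3]
[cite: NeukirchSchmidtWingberg2008, I §5 Prop. (1.5.3)(iv), I §6 (1.6.4)] -/
theorem dvd_mul_log_valuation_of_dualShapiro_mem_twisted_of_eq (vbar : HeightOneSpectrum (𝓞 K))
    (hDU : ∀ σ : absoluteGaloisGroup K, ∃ τ ∈ GreenbergSelmer.decomp vbar, τ⁻¹ * σ ∈ U)
    (hεD : ∀ σ ∈ GreenbergSelmer.decomp vbar, ε σ = 1)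
    {s : absoluteGaloisGroup K ⧸ U → absoluteGaloisGroup K}
    (hs : ∀ y, (s y : absoluteGaloisGroup K ⧸ U) = y) (hs1 : s ((1 : absoluteGaloisGroup K) : absoluteGaloisGroup K ⧸ U) = 1)
    (φ : contOneCocycles (discreteTopRep U M'))
    (hvbar : galoisCohomology.localization ((ρ.coind U hUopen).tateDual n) (Sum.inr vbar) 1
        (cohomologyMap (coindTateDualMor ρ (ofSMul M' hM') U B hUopen hB) 1
          (shapiroLift (ofSMul M' hM').toTopRep U hUopen hs hs1 (oneCocycleClass _ φ))) ∈
      (LocalInvariants.canonical K n).dualLocalCondition (ρ.coind U hUopen) (Sum.inr vbar)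
        (unramifiedSubgroup (GaloisRep.toLocal vbar (ρ.coind U hUopen)) 1))
    (β : (AlgebraicClosure K)ˣ)
    (hβ : ∀ u : galFixing K F', Additive.toMul (ι' (φ.1 ⟨u, hU' u.2⟩)) = (u : absoluteGaloisGroup K) • β / β)
    (b : F') (hb : ((b : F') : AlgebraicClosure K) = ((β ^ n : (AlgebraicClosure K)ˣ) : AlgebraicClosure K))
    (w' : vbar.Extension (𝓞 F')) : (n : ℤ) ∣ (U.index : ℤ) * WithZero.log (w'.1.valuation F' b) := by
  subst hUF
  exact dvd_mul_log_valuation_of_dualShapiro_mem_twisted ρ hM' B hB F F' hUopen ε hε hU' hεU' hker hm₀ hn0 hMn' ι' hι'B hι' vbar hDU hεD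
    hs hs1 φ hvbar β hβ b hb w'

end OfEq

/-! ## §2. -w8 g5's `hB1`, discharged -/

section B1

variable {K : Type} [Field K]

/-- A sign `ε′` with `ε′ σ = 1 ↔ unitChar θ′ σ = 1` for a quadratic framed `θ′` has open kernel (`ker ε′ = ker θ′`,
`unitChar_eq_one_iff_apply_eq_one`, `isOpen_ker_of_sq_eq_one`). [cite: KellerYin2024, §1.1] -/
theorem isOpen_ker_of_iff_unitChar (θ' : FramedGaloisRep K (padicCoeffIntegers (∅ : Set (PadicAlgCl 2))) 1)
    (hθ' : ∀ σ : absoluteGaloisGroup K, θ' σ ^ 2 = 1) (ε' : absoluteGaloisGroup K →* ℤˣ)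
    (hiff : ∀ σ, ε' σ = 1 ↔ unitChar θ' σ = 1) :
    IsOpen ((ε'.ker : Subgroup (absoluteGaloisGroup K)) : Set (absoluteGaloisGroup K)) := by
  have hker : ((ε'.ker : Subgroup (absoluteGaloisGroup K)) : Set (absoluteGaloisGroup K)) =
      ((θ'.toMonoidHom.ker : Subgroup (absoluteGaloisGroup K)) : Set (absoluteGaloisGroup K)) := by
    ext σ
    rw [SetLike.mem_coe, SetLike.mem_coe, MonoidHom.mem_ker, MonoidHom.mem_ker, hiff, KummerUDict.unitChar_eq_one_iff_apply_eq_one]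
    rfl
  rw [hker]
  exact KummerUDict.isOpen_ker_of_sq_eq_one θ' hθ'

/-- **-w8 g5's displayed hypothesis `hB1` of `LayerShapiro.xRegularAtTwo_of_decompReading`, DISCHARGED** (VERBATIM its binder list;
the θ′-, bijectivity- and injectivity-binders are not needed and ignored): for every imaginary quadratic `K` with `2 ∤ h_K`, `2 = v v̄`,
`κ` unramified outside `v̄`, layer `n`, quadratic `θ′` with sign `ε′` TRIVIAL ON `D_v̄`, layer field `F′ = K^{(v̄)}_n · K_{ε′}`
(`Gal(K̄/F′) = κ.layerSubgroup n ∩ ker ε′`), sign-level models `(N, N′, B, ι′, m₀)` at level `2^M`, representatives and layer cocycle `φ`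
satisfying clause (iii) at `v̄`, Kummer data `ι′(φ u) = uβ/β`, `β^{2^M} = b′ ∈ F′`: **`2^M ∣ ord_{w′}(b′)` at EVERY `w′ ∣ v̄`** (left disjunct).
`= dvd_log_valuation_of_dualShapiro_mem_twisted_of_eq` at `U := κ.layerSubgroup n`, `F := κ.layer n` (`galFixing_layer`), `htot` from
`forall_exists_inertia_mul_mem_galFixing_layer` (-w3 g14). [cite: SerreLocalFields1979, XIV §1 Prop. 3] [cite: deShalit1987, II.1.8, II.4.17] -/
theorem twistedVbarReading_B1 : ∀ (K : Type) [Field K] [NumberField K], IsImaginaryQuadratic K → ¬ 2 ∣ NumberField.classNumber K →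
      ∀ (v vbar : HeightOneSpectrum (𝓞 K)),
        ((2 : ℕ) : 𝓞 K) ∈ v.asIdeal → ((2 : ℕ) : 𝓞 K) ∈ vbar.asIdeal → vbar ≠ v →
      ∀ (κ : ZpExtension K 2), κ.IsUnramifiedOutside vbar → ∀ (n : ℕ) [Fintype (absoluteGaloisGroup K ⧸ κ.layerSubgroup n)],
      ∀ (θ' : FramedGaloisRep K (padicCoeffIntegers (∅ : Set (PadicAlgCl 2))) 1), (∀ σ : absoluteGaloisGroup K, θ' σ ^ 2 = 1) →
      ∀ ε' : absoluteGaloisGroup K →* ℤˣ, (∀ σ, ε' σ = 1 ↔ unitChar θ' σ = 1) → (∀ σ ∈ decomp (K := K) vbar, ε' σ = 1) →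
      ∀ (F' : IntermediateField K (AlgebraicClosure K)) [FiniteDimensional K F'] [IsAbelianGalois K F'] [NumberField F']
      [(galFixing K F').Normal] (hU' : galFixing K F' ≤ κ.layerSubgroup n) (_ : ∀ u ∈ galFixing K F', ε' u = 1)
      (_ : ∀ u ∈ κ.layerSubgroup n, ε' u = 1 → u ∈ galFixing K F')
      (M : ℕ) {N : Type} [AddCommGroup N] [DistribMulAction (absoluteGaloisGroup K) N] [TopologicalSpace N]
        [DiscreteTopology N] [Finite N]
      {N' : Type} [AddCommGroup N'] [DistribMulAction (absoluteGaloisGroup K) N'] [TopologicalSpace N'] [DiscreteTopology N']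
      [Finite N']
      (hN : ∀ m : N, IsOpen {σ : absoluteGaloisGroup K | σ • m = m}) (hN' : ∀ m : N', IsOpen {σ : absoluteGaloisGroup K | σ • m = m})
      (_ : ∀ (σ : absoluteGaloisGroup K) (x : N), σ • x = ((ε' σ : ℤˣ) : ℤ) • x) (_ : ∀ x : N, 2 ^ M • x = 0)
      (_ : ∀ x : N', 2 ^ M • x = 0)
      (B : N →+ N' →+ MuCarrier K (2 ^ M))
      (hB : ∀ (σ : absoluteGaloisGroup K) (m : N) (m' : N'), B (ofSMul N hN σ m) (ofSMul N' hN' σ m') = mu K (2 ^ M) σ (B m m'))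
      (_ : Function.Bijective fun m' : N' ↦ B.flip m')
      (ι' : N' →+ Additive (AlgebraicClosure K)ˣ) (_ : Function.Injective ι')
      (_ : ∀ (g : absoluteGaloisGroup K) (x : N'), Additive.toMul (ι' (g • x)) = (g • Additive.toMul (ι' x)) ^ ((ε' g : ℤˣ) : ℤ))
      (m₀ : N) (_ : ∀ m' : N', Additive.toMul (ι' m') = muVal K (2 ^ M) (B m₀ m'))
      {s : absoluteGaloisGroup K ⧸ κ.layerSubgroup n → absoluteGaloisGroup K}
      (hs : ∀ y, (s y : absoluteGaloisGroup K ⧸ κ.layerSubgroup n) = y)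
      (hs1 : s ((1 : absoluteGaloisGroup K) : absoluteGaloisGroup K ⧸ κ.layerSubgroup n) = 1)
      (φ : contOneCocycles (discreteTopRep (κ.layerSubgroup n) N')),
      galoisCohomology.localization (((ofSMul N hN).coind (κ.layerSubgroup n) (κ.isOpen_layerSubgroup n)).tateDual (2 ^ M))
          (Sum.inr vbar) 1
          (cohomologyMap (coindTateDualMor (ofSMul N hN) (ofSMul N' hN') (κ.layerSubgroup n) B (κ.isOpen_layerSubgroup n) hB) 1
            (shapiroLift (ofSMul N' hN').toTopRep (κ.layerSubgroup n) (κ.isOpen_layerSubgroup n) hs hs1 (oneCocycleClass _ φ))) ∈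
        (LocalInvariants.canonical K (2 ^ M)).dualLocalCondition ((ofSMul N hN).coind (κ.layerSubgroup n) (κ.isOpen_layerSubgroup n))
          (Sum.inr vbar)
          (DiscreteGaloisModule.unramifiedSubgroup
            (GaloisRep.toLocal vbar ((ofSMul N hN).coind (κ.layerSubgroup n) (κ.isOpen_layerSubgroup n))) 1) →
      ∀ β : (AlgebraicClosure K)ˣ,
        (∀ u : galFixing K F', Additive.toMul (ι' (φ.1 ⟨u, hU' u.2⟩)) = (u : absoluteGaloisGroup K) • β / β) →
        ∀ b : F', ((b : F') : AlgebraicClosure K) = ((β ^ 2 ^ M : (AlgebraicClosure K)ˣ) : AlgebraicClosure K) →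
        ∀ w' : vbar.Extension (𝓞 F'),
          ((2 ^ M : ℕ) : ℤ) ∣ WithZero.log (w'.1.valuation F' b) ∨
          ∃ 𝔓 : Ideal (absIntegers (𝓞 K) K),
            𝔓.comap (ringOfIntegersToIntegralClosure (k := K) (Ω := AlgebraicClosure K) F') = w'.1.asIdeal ∧
            ∃ s ∈ κ.layerSubgroup n, ε' s ≠ 1 ∧ s • 𝔓 = 𝔓 := by
  intro K _ _ hK h2K v vbar hv hvbar hne κ hκ n _ θ' hθ' ε' hiff hε'D F' _ _ _ _ hU' hεU' hker M N _ _ _ _ _ N' _ _ _ _ _ hN hN' hNε hMN hMN'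
    B hB _ ι' _ hι' m₀ hι'B s hs hs1 φ hvbar β hβ b hb w'
  haveI : Fact (Nat.Prime 2) := ⟨Nat.prime_two⟩
  left
  have htot : ∀ 𝔓 ∈ vbar.primesAbove, ∀ σ : absoluteGaloisGroup K,
      ∃ τ ∈ 𝔓.inertia (absoluteGaloisGroup K), τ⁻¹ * σ ∈ κ.layerSubgroup n := by
    have h := forall_exists_inertia_mul_mem_galFixing_layer (p := 2) hK h2K hκ n
    rw [galFixing_layer] at h
    exact h
  exact dvd_log_valuation_of_dualShapiro_mem_twisted_of_eq (ofSMul N hN) hN' B hB (κ.layerSubgroup n) (κ.isOpen_layerSubgroup n)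
    (κ.layer n) F' (galFixing_layer K κ n) ε' (isOpen_ker_of_iff_unitChar θ' hθ' ε' hiff) hU' hεU' hker
    (m₀ := m₀) (fun σ ↦ by rw [ofSMul_apply_apply, hNε]) (hMN m₀) hMN' ι' hι'B hι' vbar htot hε'D hs hs1 φ hvbar β hβ b hb w'

end B1

end Summit.BirchSwinnertonDyer.BirchSwinnertonDyer.Theorems.PrintCf2.NormAtVbar

end
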